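import Summits.FinalStateConjecture.FinalStateConjecture.Theorems.EIHFluxBalanceInertialRecessionStubCoerMomKernelTransport
import Summits.FinalStateConjecture.FinalStateConjecture.Theorems.EIHFluxBalanceInertialRecessionSlavingFarFieldRowsB
import Summits.FinalStateConjecture.FinalStateConjecture.Theorems.EIHFluxBalanceInertialRecessionSlavingFarFieldSpinRowsA
import Summits.FinalStateConjecture.FinalStateConjecture.Theorems.EIHFluxBalanceInertialRecessionSlavingFarFieldSpinRowsB
import Summits.FinalStateConjecture.FinalStateConjecture.Theorems.EIHFluxBalanceInertialRecessionSlavingFarFieldKernel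

/-!
# Route EIHFluxBalance — `InertialRecession` (E′), line `SketchCleanExcision`, skeleton r13,
# stub `stub_coerMomKernel` (Bk), part 8b: ASSEMBLY — the order-`R⁻⁴` kernel with a free spin
# vector and the registered stub `stub_coerMomKernel`

Closing file (for the stub; `--supports` the crux `stmt-FinalStateConjecture-17403`,
`Summit.FinalStateConjecture.FinalStateConjecture.Theses.EIHFluxBalance.InertialRecession`, E′) of the
registered stub `stub_coerMomKernel` (Bk, the LEAD's stub; proved here by seat 1) of skeleton r13:

* `bk_far_translationSpin` — the rest isometry of the frame decomposition (part 7) transports the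
  spin vector of the Lense–Thirring field by the adjugate of its spatial block (part 6b), so the
  packaged kernel step of `…SlavingFarFieldBk` (where `σ = e₃ × ω` is tied to the rotation `ω`) is
  re-packaged with `σ` FREE and a pure translation field, from `…SlavingFarFieldRowsA/B`,
  `…SpinRowsA/B`, `…Kernel`;
* **`stub_coerMomKernel`** — the registered signature: `A e₀ = 0` from the order-`R⁻³` kernel
  (`farField_boostPart_eq_zero`), then `d⃗ = 0` and, for `a ≠ 0`, `A e₃ = 0` from the order-`R⁻⁴`
  kernel with free spin vector, after transport (part 8a, `…StubCoerMomKernelTransport`).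

No definitions, no named facts, no `sorry`.
-/

set_option linter.dupNamespace false
set_option maxSynthPendingDepth 6
set_option synthInstance.maxHeartbeats 200000

noncomputable section

open Set Function Filter ContinuousLinearMap Literature.Geometry.Lorentzian
  Literature.Geometry.Lorentzian.MetricCoord Literature.Geometry.Lorentzian.Schwarzschild
open scoped Topology ContDiff InnerProductSpace

namespace Summit.FinalStateConjecture.FinalStateConjecture.Theorems.SublinearIsFree.Slaving

/-! ### The order-`R⁻⁴` kernel with a free spin vector -/

/-- **Order `R⁻⁴` of Bk, free spin vector.** If the flat momentum rows of the translation field `V`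
(`A = 0`, translation `d`) plus `c ≠ 0` times the rows of the boosted Lense–Thirring field with a FREE
spin vector `σ` vanish at `(3e₁, j=1,2,3), (−3e₂, j=1), (−3e₃, j=1,2)`, then `d⃗ = 0` and `σ = 0`
(`farField_translationSpinKernel`; cf. `farField_translationSpin_eq_zero`, where `σ = e₃ × ω`). [folklore] -/
theorem bk_far_translationSpin {s c : ℝ} (hs0 : 0 ≤ s) (hs1 : s < 1) (hc : c ≠ 0)
    (hw : ‖((2 * s / (1 + s ^ 2)) • (EuclideanSpace.single 0 1 : E3))‖ < 1)
    (σ₁ σ₂ σ₃ d₀ d₁ d₂ d₃ : ℝ) (A : E4 →L[ℝ] E4)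
    (hA : ∀ u : E4, A u = ![0 * u 1 + 0 * u 2 + 0 * u 3, 0 * u 0 - 0 * u 2 + 0 * u 3,
      0 * u 0 + 0 * u 1 - 0 * u 3, 0 * u 0 - 0 * u 1 + 0 * u 2])
    (d : E4) (hd : d = ![d₀, d₁, d₂, d₃]) (V : E4 → E4 →L[ℝ] E4 →L[ℝ] ℝ)
    (hV : ∀ z, V z =
      (fderiv ℝ (Kerr.bilin 1 0) (poincareInv (Lorentz.boost ((2 * s / (1 + s ^ 2)) • (EuclideanSpace.single 0 1 : E3)) hw) 0 z) (A (poincareInv (Lorentz.boost ((2 * s / (1 + s ^ 2)) • (EuclideanSpace.single 0 1 : E3)) hw) 0 z) + d)).bilinearComp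
          ((((Lorentz.boost ((2 * s / (1 + s ^ 2)) • (EuclideanSpace.single 0 1 : E3)) hw) : E4 ≃L[ℝ] E4).symm : E4 →L[ℝ] E4)) ((((Lorentz.boost ((2 * s / (1 + s ^ 2)) • (EuclideanSpace.single 0 1 : E3)) hw) : E4 ≃L[ℝ] E4).symm : E4 →L[ℝ] E4)) +
        (Kerr.bilin 1 0 (poincareInv (Lorentz.boost ((2 * s / (1 + s ^ 2)) • (EuclideanSpace.single 0 1 : E3)) hw) 0 z)).bilinearComp
          (A.comp ((((Lorentz.boost ((2 * s / (1 + s ^ 2)) • (EuclideanSpace.single 0 1 : E3)) hw) : E4 ≃L[ℝ] E4).symm : E4 →L[ℝ] E4))) ((((Lorentz.boost ((2 * s / (1 + s ^ 2)) • (EuclideanSpace.single 0 1 : E3)) hw) : E4 ≃L[ℝ] E4).symm : E4 →L[ℝ] E4)) +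
        (Kerr.bilin 1 0 (poincareInv (Lorentz.boost ((2 * s / (1 + s ^ 2)) • (EuclideanSpace.single 0 1 : E3)) hw) 0 z)).bilinearComp
          ((((Lorentz.boost ((2 * s / (1 + s ^ 2)) • (EuclideanSpace.single 0 1 : E3)) hw) : E4 ≃L[ℝ] E4).symm : E4 →L[ℝ] E4)) (A.comp ((((Lorentz.boost ((2 * s / (1 + s ^ 2)) • (EuclideanSpace.single 0 1 : E3)) hw) : E4 ≃L[ℝ] E4).symm : E4 →L[ℝ] E4))))
    (S : E4 → E4 → E4 → ℝ)
    (hS : ∀ z u w : E4, S z u w =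
      2 / E4.spatialNorm (((Lorentz.boost ((2 * s / (1 + s ^ 2)) • (EuclideanSpace.single 0 1 : E3)) hw) : E4 ≃L[ℝ] E4).symm z) ^ 3 *
        (ell (((Lorentz.boost ((2 * s / (1 + s ^ 2)) • (EuclideanSpace.single 0 1 : E3)) hw) : E4 ≃L[ℝ] E4).symm z) (((Lorentz.boost ((2 * s / (1 + s ^ 2)) • (EuclideanSpace.single 0 1 : E3)) hw) : E4 ≃L[ℝ] E4).symm u) * sdot (((Lorentz.boost ((2 * s / (1 + s ^ 2)) • (EuclideanSpace.single 0 1 : E3)) hw) : E4 ≃L[ℝ] E4).symm z) (WithLp.toLp 2 ![(0 : ℝ), σ₂ * (((Lorentz.boost ((2 * s / (1 + s ^ 2)) • (EuclideanSpace.single 0 1 : E3)) hw) : E4 ≃L[ℝ] E4).symm w) 3 - σ₃ * (((Lorentz.boost ((2 * s / (1 + s ^ 2)) • (EuclideanSpace.single 0 1 : E3)) hw) : E4 ≃L[ℝ] E4).symm w) 2, σ₃ * (((Lorentz.boost ((2 * s / (1 + s ^ 2)) • (EuclideanSpace.single 0 1 : E3)) hw) : E4 ≃L[ℝ] E4).symm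 w) 1 - σ₁ * (((Lorentz.boost ((2 * s / (1 + s ^ 2)) • (EuclideanSpace.single 0 1 : E3)) hw) : E4 ≃L[ℝ] E4).symm w) 3, σ₁ * (((Lorentz.boost ((2 * s / (1 + s ^ 2)) • (EuclideanSpace.single 0 1 : E3)) hw) : E4 ≃L[ℝ] E4).symm w) 2 - σ₂ * (((Lorentz.boost ((2 * s / (1 + s ^ 2)) • (EuclideanSpace.single 0 1 : E3)) hw) : E4 ≃L[ℝ] E4).symm w) 1]) +
          sdot (((Lorentz.boost ((2 * s / (1 + s ^ 2)) • (EuclideanSpace.single 0 1 : E3)) hw) : E4 ≃L[ℝ] E4).symm z) (WithLp.toLp 2 ![(0 : ℝ), σ₂ * (((Lorentz.boost ((2 * s / (1 + s ^ 2)) • (EuclideanSpace.single 0 1 : E3)) hw) : E4 ≃L[ℝ] E4).symm u) 3 - σ₃ * (((Lorentz.boost ((2 * s / (1 + s ^ 2)) • (EuclideanSpace.single 0 1 : E3)) hw) : E4 ≃L[ℝ] E4).symm u) 2, σ₃ * (((Lorentz.boost ((2 * s / (1 + s ^ 2)) • (EuclideanSpace.single 0 1 : E3)) hw) : E4 ≃L[ℝ]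 E4).symm u) 1 - σ₁ * (((Lorentz.boost ((2 * s / (1 + s ^ 2)) • (EuclideanSpace.single 0 1 : E3)) hw) : E4 ≃L[ℝ] E4).symm u) 3, σ₁ * (((Lorentz.boost ((2 * s / (1 + s ^ 2)) • (EuclideanSpace.single 0 1 : E3)) hw) : E4 ≃L[ℝ] E4).symm u) 2 - σ₂ * (((Lorentz.boost ((2 * s / (1 + s ^ 2)) • (EuclideanSpace.single 0 1 : E3)) hw) : E4 ≃L[ℝ] E4).symm u) 1]) * ell (((Lorentz.boost ((2 * s / (1 + s ^ 2)) • (EuclideanSpace.single 0 1 : E3)) hw) : E4 ≃L[ℝ] E4).symm z) (((Lorentz.boost ((2 * s / (1 + s ^ 2)) • (EuclideanSpace.single 0 1 : E3)) hw) : E4 ≃L[ℝ] E4).symm w)))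
    (hP1 : (∑ i : Fin 3, (fderiv ℝ V (E4.ofTimeSpace 0 ((3 : ℝ) • EuclideanSpace.single 0 1)) (E4.basisVector i.succ) (E4.basisVector i.succ) (E4.basisVector 1) -
        fderiv ℝ V (E4.ofTimeSpace 0 ((3 : ℝ) • EuclideanSpace.single 0 1)) (E4.basisVector 1) (E4.basisVector i.succ) (E4.basisVector i.succ))) + c * (∑ i : Fin 3, (fderiv ℝ (fun z ↦ S z (E4.basisVector i.succ) (E4.basisVector 1)) (E4.ofTimeSpace 0 ((3 : ℝ) • EuclideanSpace.single 0 1)) (E4.basisVector i.succ) -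
        fderiv ℝ (fun z ↦ S z (E4.basisVector i.succ) (E4.basisVector i.succ)) (E4.ofTimeSpace 0 ((3 : ℝ) • EuclideanSpace.single 0 1)) (E4.basisVector 1))) = 0)
    (hP2 : (∑ i : Fin 3, (fderiv ℝ V (E4.ofTimeSpace 0 ((3 : ℝ) • EuclideanSpace.single 0 1)) (E4.basisVector i.succ) (E4.basisVector i.succ) (E4.basisVector 2) -
        fderiv ℝ V (E4.ofTimeSpace 0 ((3 : ℝ) • EuclideanSpace.single 0 1)) (E4.basisVector 2) (E4.basisVector i.succ) (E4.basisVector i.succ))) + c * (∑ i : Fin 3, (fderiv ℝ (fun z ↦ S z (E4.basisVector i.succ) (E4.basisVector 2)) (E4.ofTimeSpace 0 ((3 : ℝ) • EuclideanSpace.single 0 1)) (E4.basisVector i.succ) -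
        fderiv ℝ (fun z ↦ S z (E4.basisVector i.succ) (E4.basisVector i.succ)) (E4.ofTimeSpace 0 ((3 : ℝ) • EuclideanSpace.single 0 1)) (E4.basisVector 2))) = 0)
    (hP3 : (∑ i : Fin 3, (fderiv ℝ V (E4.ofTimeSpace 0 ((3 : ℝ) • EuclideanSpace.single 0 1)) (E4.basisVector i.succ) (E4.basisVector i.succ) (E4.basisVector 3) -
        fderiv ℝ V (E4.ofTimeSpace 0 ((3 : ℝ) • EuclideanSpace.single 0 1)) (E4.basisVector 3) (E4.basisVector i.succ) (E4.basisVector i.succ))) + c * (∑ i : Fin 3, (fderiv ℝ (fun z ↦ S z (E4.basisVector i.succ) (E4.basisVector 3)) (E4.ofTimeSpace 0 ((3 : ℝ) • EuclideanSpace.single 0 1)) (E4.basisVector i.succ) -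
        fderiv ℝ (fun z ↦ S z (E4.basisVector i.succ) (E4.basisVector i.succ)) (E4.ofTimeSpace 0 ((3 : ℝ) • EuclideanSpace.single 0 1)) (E4.basisVector 3))) = 0)
    (hQ1 : (∑ i : Fin 3, (fderiv ℝ V (E4.ofTimeSpace 0 ((-3 : ℝ) • EuclideanSpace.single 1 1)) (E4.basisVector i.succ) (E4.basisVector i.succ) (E4.basisVector 1) -
        fderiv ℝ V (E4.ofTimeSpace 0 ((-3 : ℝ) • EuclideanSpace.single 1 1)) (E4.basisVector 1) (E4.basisVector i.succ) (E4.basisVector i.succ))) + c * (∑ i : Fin 3, (fderiv ℝ (fun z ↦ S z (E4.basisVector i.succ) (E4.basisVector 1)) (E4.ofTimeSpace 0 ((-3 : ℝ) • EuclideanSpace.single 1 1)) (E4.basisVector i.succ) -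
        fderiv ℝ (fun z ↦ S z (E4.basisVector i.succ) (E4.basisVector i.succ)) (E4.ofTimeSpace 0 ((-3 : ℝ) • EuclideanSpace.single 1 1)) (E4.basisVector 1))) = 0)
    (hA1 : (∑ i : Fin 3, (fderiv ℝ V (E4.ofTimeSpace 0 ((-3 : ℝ) • EuclideanSpace.single 2 1)) (E4.basisVector i.succ) (E4.basisVector i.succ) (E4.basisVector 1) -
        fderiv ℝ V (E4.ofTimeSpace 0 ((-3 : ℝ) • EuclideanSpace.single 2 1)) (E4.basisVector 1) (E4.basisVector i.succ) (E4.basisVector i.succ))) + c * (∑ i : Fin 3, (fderiv ℝ (fun z ↦ S z (E4.basisVector i.succ) (E4.basisVector 1)) (E4.ofTimeSpace 0 ((-3 : ℝ) • EuclideanSpace.single 2 1)) (E4.basisVector i.succ) -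
        fderiv ℝ (fun z ↦ S z (E4.basisVector i.succ) (E4.basisVector i.succ)) (E4.ofTimeSpace 0 ((-3 : ℝ) • EuclideanSpace.single 2 1)) (E4.basisVector 1))) = 0)
    (hA2 : (∑ i : Fin 3, (fderiv ℝ V (E4.ofTimeSpace 0 ((-3 : ℝ) • EuclideanSpace.single 2 1)) (E4.basisVector i.succ) (E4.basisVector i.succ) (E4.basisVector 2) -
        fderiv ℝ V (E4.ofTimeSpace 0 ((-3 : ℝ) • EuclideanSpace.single 2 1)) (E4.basisVector 2) (E4.basisVector i.succ) (E4.basisVector i.succ))) + c * (∑ i : Fin 3, (fderiv ℝ (fun z ↦ S z (E4.basisVector i.succ) (E4.basisVector 2)) (E4.ofTimeSpace 0 ((-3 : ℝ) • EuclideanSpace.single 2 1)) (E4.basisVector i.succ) -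
        fderiv ℝ (fun z ↦ S z (E4.basisVector i.succ) (E4.basisVector i.succ)) (E4.ofTimeSpace 0 ((-3 : ℝ) • EuclideanSpace.single 2 1)) (E4.basisVector 2))) = 0) :
    d₁ = 0 ∧ d₂ = 0 ∧ d₃ = 0 ∧ σ₁ = 0 ∧ σ₂ = 0 ∧ σ₃ = 0 := by
  have hs : |s| < 1 := abs_lt.2 ⟨by linarith, hs1⟩
  rw [farField_row_P1 hs hw 0 0 0 0 0 0 d₀ d₁ d₂ d₃ A hA d hd V hV, farField_spinRow_P1 hs hw σ₁ σ₂ σ₃ S hS] at hP1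
  rw [farField_row_P2 hs hw 0 0 0 0 0 0 d₀ d₁ d₂ d₃ A hA d hd V hV, farField_spinRow_P2 hs hw σ₁ σ₂ σ₃ S hS] at hP2
  rw [farField_row_P3 hs hw 0 0 0 0 0 0 d₀ d₁ d₂ d₃ A hA d hd V hV, farField_spinRow_P3 hs hw σ₁ σ₂ σ₃ S hS] at hP3
  rw [farField_row_Qm1 hs hw 0 0 0 0 0 0 d₀ d₁ d₂ d₃ A hA d hd V hV, farField_spinRow_Qm1 hs hw σ₁ σ₂ σ₃ S hS] at hQ1
  rw [farField_row_Am1 hs hw 0 0 0 0 0 0 d₀ d₁ d₂ d₃ A hA d hd V hV, farField_spinRow_Am1 hs hw σ₁ σ₂ σ₃ S hS] at hA1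
  rw [farField_row_Am2 hs hw 0 0 0 0 0 0 d₀ d₁ d₂ d₃ A hA d hd V hV, farField_spinRow_Am2 hs hw σ₁ σ₂ σ₃ S hS] at hA2
  simp only [mul_zero, zero_sub] at hP1 hP2 hP3 hQ1 hA1 hA2
  exact farField_translationSpinKernel (a := c) hs0 hs1 hc (d₁ := d₁) (d₂ := d₂) (d₃ := d₃)
    (σ₁ := σ₁) (σ₂ := σ₂) (σ₃ := σ₃) (by linarith [hP1]) (by linarith [hP2]) (by linarith [hP3]) (by linarith [hQ1])
    (by linarith [hA1]) (by linarith [hA2])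

/-! ### The registered stub -/

/-- Reversing a difference inside a finite sum. [folklore] -/
theorem bk_sum_swap (f g : Fin 3 → ℝ) : ∑ i, (g i - f i) = -∑ i, (f i - g i) := by
  rw [← Finset.sum_neg_distrib]
  simp only [neg_sub]

set_option maxHeartbeats 12800000 in
/-- **Bk · COER-mom KERNEL — every boost, every spin** (registered stub `stub_coerMomKernel` of the
line `SketchCleanExcision`, crux E′). If the momentum rows of the first-order modulated model
`K + x⁰Var_{(M,a,A,d)}`, `K = boostedKerrBilin L 0 M a`, vanish at all far lab offsets, then the
motion is instantaneously a Kerr–Schild stabiliser: `A e₀ = 0`, `d⃗ = 0`, and `A e₃ = 0` for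
`a ≠ 0`. Proof: the far-field (graded) limit (parts 1–5) gives the two flat identities for the frame
`S = Λ⁻¹`; the frame decomposition `S = R ∘ boost(v e₁)⁻¹ ∘ N` (part 7) and covariance (part 6)
transport them to the tabulated frame; the order-`R⁻³` kernel (`farField_boostPart_eq_zero`) kills the
boost part and the order-`R⁻⁴` kernel with free spin vector (`bk_far_translationSpin`) the
translation and the tilt of the axis. [folklore] -/
theorem stub_coerMomKernel :
    (∀ (M a : ℝ), |a| < M → ∀ (L : lorentzGroup) (A : E4 →L[ℝ] E4) (d : E4) (ρ₀ : ℝ), (∀ u w : E4, Minkowski.bilin (A u) w + Minkowski.bilin u (A w) = 0) → (∀ y : E3, ρ₀ ≤ ‖y‖ → 2 * M < Kerr.radius a (poincareInv L 0 (E4.ofTimeSpace 0 y)) → ∀ j : Fin 3, MetricCoord.ricAt (fun z : E4 ↦ (boostedKerrBilin L 0 M a) z + (z 0) • ((fderiv ℝ (Kerr.bilin M a) (poincareInv L 0 z) (A (poincareInv L 0 z) + d)).bilinearComp (((L : E4 ≃L[ℝ] E4).symm : E4 →L[ℝ] E4)) (((L : E4 ≃L[ℝ] E4).symm : E4 →L[ℝ]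 E4)) + (Kerr.bilin M a (poincareInv L 0 z)).bilinearComp (A.comp (((L : E4 ≃L[ℝ] E4).symm : E4 →L[ℝ] E4))) (((L : E4 ≃L[ℝ] E4).symm : E4 →L[ℝ] E4)) + (Kerr.bilin M a (poincareInv L 0 z)).bilinearComp (((L : E4 ≃L[ℝ] E4).symm : E4 →L[ℝ] E4)) (A.comp (((L : E4 ≃L[ℝ] E4).symm : E4 →L[ℝ] E4))))) (E4.ofTimeSpace 0 y) (MetricCoord.sharpAt (boostedKerrBilin L 0 M a) (E4.ofTimeSpace 0 y) (E4.dx 0)) (E4.basisVector j.succ) = 0) → A (E4.basisVector 0) = 0 ∧ E4.spatial d = 0 ∧ (a ≠ 0 → A (E4.basisVector 3) = 0)) := by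
  intro M a haM L A d ρ₀ hA H
  have hM : 0 < M := lt_of_le_of_lt (abs_nonneg a) haM
  set S : E4 →L[ℝ] E4 := ((L : E4 ≃L[ℝ] E4).symm : E4 →L[ℝ] E4) with hS
  -- the hypothesis in frame form, for every spatial vector
  have hpt : poincareInv L 0 = ⇑S := coerMomQ_poincareInv_zero_eq L
  have H' : ∀ y : E3, ρ₀ ≤ ‖y‖ → 2 * M < Kerr.radius a (S (E4.ofTimeSpace 0 y)) → ∀ e : E4, e 0 = 0 →
      ricAt (fun z : E4 ↦ boostedKerrBilin L 0 M a z + (z 0) • ((fderiv ℝ (Kerr.bilin M a) (S z) (A (S z) + d)).bilinearComp S S + (Kerr.bilin M a (S z)).bilinearComp (A.comp S) S + (Kerr.bilin M a (S z)).bilinearComp S (A.comp S))) (E4.ofTimeSpace 0 y) (sharpAt (boostedKerrBilin L 0 M a) (E4.ofTimeSpace 0 y) (E4.dx 0)) e = 0 := by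
    intro y hy hr e he
    have hr' : 2 * M < Kerr.radius a (poincareInv L 0 (E4.ofTimeSpace 0 y)) := by rw [hpt]; exact hr
    have hj := H y hy hr'
    simp only [hpt] at hj
    have he' : e = e 1 • E4.basisVector 1 + e 2 • E4.basisVector 2 + e 3 • E4.basisVector 3 := by
      have h := QuasiStationarity.eq_sum_basisVector e
      rw [he, zero_smul, zero_add] at h
      exact h
    have h1 := hj 0
    have h2 := hj 1
    have h3 := hj 2
    simp only [Fin.succ_zero_eq_one, Fin.succ_one_eq_two] at h1 h2
    rw [show ((2 : Fin 3).succ : Fin 4) = 3 from rfl] at h3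
    rw [he', map_add, map_add, map_smul, map_smul, map_smul, h1, h2, h3, smul_zero, smul_zero, smul_zero,
      add_zero, add_zero]
  -- the frame decomposition
  obtain ⟨s, hw, N, Rr, Rinv, hs0, hs1, hNiso, hNN, hNe0, hRiso, hR0, hRRinv, hRinvR, hdec⟩ :=
    bk_frame_decomposition L
  have hsabs : |s| < 1 := abs_lt.2 ⟨by linarith, hs1⟩
  set Lb := Lorentz.boost ((2 * s / (1 + s ^ 2)) • (EuclideanSpace.single 0 1 : E3)) hw with hLb
  set S₀ : E4 →L[ℝ] E4 := ((Lb : E4 ≃L[ℝ] E4).symm : E4 →L[ℝ] E4) with hS₀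
  have hpI : poincareInv Lb 0 = ⇑S₀ := coerMomQ_poincareInv_zero_eq Lb
  have hRinv0 : Rinv (E4.basisVector 0) = E4.basisVector 0 := by
    conv_lhs => rw [← hR0]
    exact hRinvR _
  -- the table points
  have hptfacts : ∀ (c : ℝ) (k : Fin 3), c ≠ 0 →
      (E4.ofTimeSpace 0 (c • EuclideanSpace.single k 1) : E4) 0 = 0 ∧
      0 < Kerr.radius 0 (S₀ (E4.ofTimeSpace 0 (c • EuclideanSpace.single k 1))) ∧
      N (E4.ofTimeSpace 0 (c • EuclideanSpace.single k 1)) 0 = 0 ∧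
      N (E4.ofTimeSpace 0 (c • EuclideanSpace.single k 1)) ≠ 0 := by
    intro c k hc
    have h0 : (E4.ofTimeSpace 0 (c • EuclideanSpace.single k 1) : E4) 0 = 0 := by simp
    have hne : (E4.ofTimeSpace 0 (c • EuclideanSpace.single k 1) : E4) ≠ 0 := by
      intro h
      have h' := congrArg (fun v : E4 ↦ v k.succ) h
      simp at h'
      exact hc h'
    refine ⟨h0, bk_radius_pos_slice Lb h0 hne, bk_labIso_apply_zero_of_spatial hNiso hNe0 h0, ?_⟩
    intro h
    apply hne
    rw [← hNN (E4.ofTimeSpace 0 (c • EuclideanSpace.single k 1)), h, map_zero]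
  have he0 : ∀ j : Fin 4, j ≠ 0 → (E4.basisVector j : E4) 0 = 0 := fun j hj ↦ by simp [hj.symm]
  ------------------------------------------------------------------
  -- STEP ONE: the boost part vanishes
  ------------------------------------------------------------------
  set A' : E4 →L[ℝ] E4 := (Rinv.comp A).comp Rr with hA'
  have hA'skew : ∀ u w : E4, Minkowski.bilin (A' u) w + Minkowski.bilin u (A' w) = 0 := by
    intro u w
    have e1 : Minkowski.bilin (A' u) w = Minkowski.bilin (A (Rr u)) (Rr w) := by
      show Minkowski.bilin (Rinv (A (Rr u))) w = _
      conv_lhs => rw [← hRiso, hRRinv]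
    have e2 : Minkowski.bilin u (A' w) = Minkowski.bilin (Rr u) (A (Rr w)) := by
      show Minkowski.bilin u (Rinv (A (Rr w))) = _
      conv_lhs => rw [← hRiso, hRRinv]
    rw [e1, e2]
    exact hA (Rr u) (Rr w)
  have hA'form := skew_matrix_form hA'skew
  set V₁ : E4 → E4 →L[ℝ] E4 →L[ℝ] ℝ := fun z ↦ ((fderiv ℝ (Kerr.bilin 1 0) (S₀ z) ((A') (S₀ z) + Rinv 0)).bilinearComp (S₀) (S₀) + (Kerr.bilin 1 0 (S₀ z)).bilinearComp ((A').comp (S₀)) (S₀) + (Kerr.bilin 1 0 (S₀ z)).bilinearComp (S₀) ((A').comp (S₀))) with hV₁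
  have hV₁' : ∀ z : E4, V₁ z = (fderiv ℝ (Kerr.bilin 1 0) (poincareInv Lb 0 z) ((A') (poincareInv Lb 0 z) + Rinv 0)).bilinearComp S₀ S₀ + (Kerr.bilin 1 0 (poincareInv Lb 0 z)).bilinearComp ((A').comp S₀) S₀ + (Kerr.bilin 1 0 (poincareInv Lb 0 z)).bilinearComp S₀ ((A').comp S₀) := by
    intro z
    simp only [hV₁, hpI]
  have hrowsI : ∀ {q : E4}, q 0 = 0 → 0 < Kerr.radius 0 (S₀ q) → ∀ {e : E4}, e 0 = 0 →
      ∑ i : Fin 3, (fderiv ℝ V₁ q e (E4.basisVector i.succ) (E4.basisVector i.succ)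
        - fderiv ℝ V₁ q (E4.basisVector i.succ) (E4.basisVector i.succ) e) = 0 := by
    intro q hq0 hq e he
    rw [hV₁]
    exact bk_transport_var A 0 hNiso hNN hNe0 hRiso hR0 hRRinv hdec
      (fun x hx0 hx e he ↦ bk_rows_I hM L hA d H' hx0 hx he) hq0 hq he
  obtain ⟨hP0, hPr, hPN0, hPN⟩ := hptfacts 3 0 (by norm_num)
  obtain ⟨hQ0, hQr, hQN0, hQN⟩ := hptfacts 3 1 (by norm_num)
  obtain ⟨hR30, hR3r, hR3N0, hR3N⟩ := hptfacts 3 2 (by norm_num)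
  obtain ⟨hQm0, hQmr, hQmN0, hQmN⟩ := hptfacts (-3) 1 (by norm_num)
  obtain ⟨hAm0, hAmr, hAmN0, hAmN⟩ := hptfacts (-3) 2 (by norm_num)
  have tP1 : (∑ i : Fin 3, (fderiv ℝ V₁ (E4.ofTimeSpace 0 ((3 : ℝ) • EuclideanSpace.single 0 1)) (E4.basisVector i.succ) (E4.basisVector i.succ) (E4.basisVector 1) - fderiv ℝ V₁ (E4.ofTimeSpace 0 ((3 : ℝ) • EuclideanSpace.single 0 1)) (E4.basisVector 1) (E4.basisVector i.succ) (E4.basisVector i.succ))) = 0 := by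
    rw [bk_sum_swap, hrowsI hP0 hPr (he0 1 (by decide)), neg_zero]
  have tQ2 : (∑ i : Fin 3, (fderiv ℝ V₁ (E4.ofTimeSpace 0 ((3 : ℝ) • EuclideanSpace.single 1 1)) (E4.basisVector i.succ) (E4.basisVector i.succ) (E4.basisVector 2) - fderiv ℝ V₁ (E4.ofTimeSpace 0 ((3 : ℝ) • EuclideanSpace.single 1 1)) (E4.basisVector 2) (E4.basisVector i.succ) (E4.basisVector i.succ))) = 0 := by
    rw [bk_sum_swap, hrowsI hQ0 hQr (he0 2 (by decide)), neg_zero]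
  have tA3 : (∑ i : Fin 3, (fderiv ℝ V₁ (E4.ofTimeSpace 0 ((3 : ℝ) • EuclideanSpace.single 2 1)) (E4.basisVector i.succ) (E4.basisVector i.succ) (E4.basisVector 3) - fderiv ℝ V₁ (E4.ofTimeSpace 0 ((3 : ℝ) • EuclideanSpace.single 2 1)) (E4.basisVector 3) (E4.basisVector i.succ) (E4.basisVector i.succ))) = 0 := by
    rw [bk_sum_swap, hrowsI hR30 hR3r (he0 3 (by decide)), neg_zero]
  obtain ⟨hb1, hb2, hb3⟩ := farField_boostPart_eq_zero hs0 hs1 hw (A' (E4.basisVector 0) 1)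
    (A' (E4.basisVector 0) 2) (A' (E4.basisVector 0) 3) (A' (E4.basisVector 2) 3) (A' (E4.basisVector 3) 1)
    (A' (E4.basisVector 1) 2) A' hA'form (Rinv 0) (map_zero _) V₁ hV₁' tP1 tQ2 tA3
  have hA'0 : A' (E4.basisVector 0) = 0 := by
    have h0v : A' (E4.basisVector 0) = ![(0 : ℝ), A' (E4.basisVector 0) 1, A' (E4.basisVector 0) 2,
        A' (E4.basisVector 0) 3] := skew_apply_basisVector_zero hA'skew
    ext i
    rw [h0v]
    fin_cases i <;> simp [hb1, hb2, hb3]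
  have hA0 : A (E4.basisVector 0) = 0 := by
    have h : A (E4.basisVector 0) = Rr (A' (Rinv (E4.basisVector 0))) := by
      show A (E4.basisVector 0) = Rr (Rinv (A (Rr (Rinv (E4.basisVector 0)))))
      rw [hRRinv, hRRinv]
    rw [h, hRinv0, hA'0, map_zero]
  refine ⟨hA0, ?_⟩
  ------------------------------------------------------------------
  -- STEP TWO: translations and the tilt of the axis
  ------------------------------------------------------------------
  -- the rotation form of `A`
  have hRform : ∀ u : E4, A u = ![0, A (E4.basisVector 3) 1 * u 3 - A (E4.basisVector 1) 2 * u 2,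
      A (E4.basisVector 1) 2 * u 1 - A (E4.basisVector 2) 3 * u 3,
      A (E4.basisVector 2) 3 * u 2 - A (E4.basisVector 3) 1 * u 1] := by
    intro u
    rw [skew_matrix_form hA u]
    have h01 : A (E4.basisVector 0) 1 = 0 := by rw [hA0]; rfl
    have h02 : A (E4.basisVector 0) 2 = 0 := by rw [hA0]; rfl
    have h03 : A (E4.basisVector 0) 3 = 0 := by rw [hA0]; rfl
    rw [h01, h02, h03]
    funext i; fin_cases i <;> simp <;> ring
  obtain ⟨σ₁', σ₂', σ₃', hback, hsp⟩ := bk_transport_spin A (A (E4.basisVector 2) 3) (A (E4.basisVector 3) 1)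
    (A (E4.basisVector 1) 2) hRform hNiso hNN hNe0 hRiso hR0 hRRinv hdec
  -- the translated field in the table frame and the scalar spin field
  set V₂ : E4 → E4 →L[ℝ] E4 →L[ℝ] ℝ := fun z ↦ ((fderiv ℝ (Kerr.bilin 1 0) (S₀ z) (((Rinv.comp (0 : E4 →L[ℝ] E4)).comp Rr) (S₀ z) + Rinv d)).bilinearComp (S₀) (S₀) + (Kerr.bilin 1 0 (S₀ z)).bilinearComp (((Rinv.comp (0 : E4 →L[ℝ] E4)).comp Rr).comp (S₀)) (S₀) + (Kerr.bilin 1 0 (S₀ z)).bilinearComp (S₀) (((Rinv.comp (0 : E4 →L[ℝ] E4)).comp Rr).comp (S₀))) with hV₂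
  have hV₂' : ∀ z : E4, V₂ z = (fderiv ℝ (Kerr.bilin 1 0) (poincareInv Lb 0 z) (((Rinv.comp (0 : E4 →L[ℝ] E4)).comp Rr) (poincareInv Lb 0 z) + Rinv d)).bilinearComp S₀ S₀ + (Kerr.bilin 1 0 (poincareInv Lb 0 z)).bilinearComp (((Rinv.comp (0 : E4 →L[ℝ] E4)).comp Rr).comp S₀) S₀ + (Kerr.bilin 1 0 (poincareInv Lb 0 z)).bilinearComp S₀ (((Rinv.comp (0 : E4 →L[ℝ] E4)).comp Rr).comp S₀) := by
    intro z
    simp only [hV₂, hpI]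
  have hA₂form : ∀ u : E4, ((Rinv.comp (0 : E4 →L[ℝ] E4)).comp Rr) u = ![0 * u 1 + 0 * u 2 + 0 * u 3,
      0 * u 0 - 0 * u 2 + 0 * u 3, 0 * u 0 + 0 * u 1 - 0 * u 3, 0 * u 0 - 0 * u 1 + 0 * u 2] := by
    intro u
    simp only [ContinuousLinearMap.coe_comp, Function.comp_apply, _root_.zero_apply, map_zero]
    funext i; fin_cases i <;> simp
  have hd' : Rinv d = ![Rinv d 0, Rinv d 1, Rinv d 2, Rinv d 3] := by
    funext i; fin_cases i <;> rfl
  set Sf : E4 → E4 → E4 → ℝ := fun z u w ↦ 2 / E4.spatialNorm (S₀ z) ^ 3 * (ell (S₀ z) (S₀ u) * sdot (S₀ z) (WithLp.toLp 2 ![(0 : ℝ), σ₂' * (S₀ w) 3 - σ₃' * (S₀ w) 2, σ₃' * (S₀ w) 1 - σ₁' * (S₀ w) 3, σ₁' * (S₀ w) 2 - σ₂' * (S₀ w) 1]) + sdot (S₀ z) (WithLp.toLp 2 ![(0 : ℝ), σ₂' * (S₀ u) 3 - σ₃' * (S₀ u) 2, σ₃' * (S₀ u) 1 - σ₁' * (S₀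 u) 3, σ₁' * (S₀ u) 2 - σ₂' * (S₀ u) 1]) * ell (S₀ z) (S₀ w)) with hSf
  have hSf' : ∀ z u w : E4, Sf z u w = 2 / E4.spatialNorm (S₀ z) ^ 3 * (ell (S₀ z) (S₀ u) * sdot (S₀ z) (WithLp.toLp 2 ![(0 : ℝ), σ₂' * (S₀ w) 3 - σ₃' * (S₀ w) 2, σ₃' * (S₀ w) 1 - σ₁' * (S₀ w) 3, σ₁' * (S₀ w) 2 - σ₂' * (S₀ w) 1]) + sdot (S₀ z) (WithLp.toLp 2 ![(0 : ℝ), σ₂' * (S₀ u) 3 - σ₃' * (S₀ u) 2, σ₃' * (S₀ u) 1 - σ₁' * (S₀ u) 3, σ₁' * (S₀ u) 2 - σ₂' * (S₀ u) 1]) * ell (S₀ z) (S₀ w)) := fun z u w ↦ rfl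
  -- the combined rows in the table frame: `a · rows(Sf) + rows(V₂) = 0`, own orientation
  have hrowsII : ∀ {q : E4}, q 0 = 0 → 0 < Kerr.radius 0 (S₀ q) → N q 0 = 0 → N q ≠ 0 → ∀ (j : Fin 4), j ≠ 0 →
      a * ∑ i : Fin 3, (fderiv ℝ (fun z ↦ Sf z (E4.basisVector i.succ) (E4.basisVector i.succ)) q (E4.basisVector j)
          - fderiv ℝ (fun z ↦ Sf z (E4.basisVector i.succ) (E4.basisVector j)) q (E4.basisVector i.succ))
        + ∑ i : Fin 3, (fderiv ℝ V₂ q (E4.basisVector j) (E4.basisVector i.succ) (E4.basisVector i.succ)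
          - fderiv ℝ V₂ q (E4.basisVector i.succ) (E4.basisVector i.succ) (E4.basisVector j)) = 0 := by
    intro q hq0 hq hNq0 hNq j hj
    have hNej : N (E4.basisVector j) 0 = 0 := bk_labIso_apply_zero_of_spatial hNiso hNe0 (he0 j hj)
    have h := bk_rows_II hM L hA hA0 d H' (x := N q) hNq0 hNq (e := N (E4.basisVector j)) hNej
    rw [hsp hq (E4.basisVector j), bk_transport_var_eq (0 : E4 →L[ℝ] E4) d hNiso hNN hNe0 hRiso hR0 hRRinv hdec hq
      (E4.basisVector j)] at h
    rw [hSf, hV₂]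
    exact h
  have uP := hrowsII hP0 hPr hPN0 hPN
  have uQm := hrowsII hQm0 hQmr hQmN0 hQmN
  have uAm := hrowsII hAm0 hAmr hAmN0 hAmN
  -- conclude for the translation
  have hspatial : Rinv d 1 = 0 ∧ Rinv d 2 = 0 ∧ Rinv d 3 = 0 ∧ (a ≠ 0 → σ₁' = 0 ∧ σ₂' = 0 ∧ σ₃' = 0) := by
    by_cases ha : a = 0
    · -- `a = 0`: feed the kernel with the zero spin field and `c = 1`
      set Sf₀ : E4 → E4 → E4 → ℝ := fun z u w ↦ 2 / E4.spatialNorm (S₀ z) ^ 3 * (ell (S₀ z) (S₀ u) * sdot (S₀ z) (WithLp.toLp 2 ![(0 : ℝ), (0:ℝ) * (S₀ w) 3 - (0:ℝ) * (S₀ w) 2, (0:ℝ) * (S₀ w) 1 - (0:ℝ) * (S₀ w) 3, (0:ℝ) * (S₀ w) 2 - (0:ℝ) * (S₀ w) 1]) + sdot (S₀ z) (WithLp.toLp 2 ![(0 : ℝ), (0:ℝ) * (S₀ u) 3 - (0:ℝ) * (S₀ u) 2, (0:ℝ) * (S₀ u) 1 - (0:ℝ) * (S₀ u) 3, (0:ℝ)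 * (S₀ u) 2 - (0:ℝ) * (S₀ u) 1]) * ell (S₀ z) (S₀ w)) with hSf₀
      have hSf₀' : ∀ z u w : E4, Sf₀ z u w = 2 / E4.spatialNorm (S₀ z) ^ 3 * (ell (S₀ z) (S₀ u) * sdot (S₀ z) (WithLp.toLp 2 ![(0 : ℝ), (0:ℝ) * (S₀ w) 3 - (0:ℝ) * (S₀ w) 2, (0:ℝ) * (S₀ w) 1 - (0:ℝ) * (S₀ w) 3, (0:ℝ) * (S₀ w) 2 - (0:ℝ) * (S₀ w) 1]) + sdot (S₀ z) (WithLp.toLp 2 ![(0 : ℝ), (0:ℝ) * (S₀ u) 3 - (0:ℝ) * (S₀ u) 2, (0:ℝ) * (S₀ u) 1 - (0:ℝ) * (S₀ u) 3, (0:ℝ) * (S₀ u) 2 - (0:ℝ) * (S₀ u) 1]) * ell (S₀ z) (S₀ w)) := fun z u w ↦ rfl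
      have hSf₀zero : ∀ u w : E4, (fun z ↦ Sf₀ z u w) = fun _ ↦ (0 : ℝ) := by
        intro u w; funext z; simp [hSf₀, sdot_eq]
      have hz : ∀ (q : E4) (j : Fin 4),
          ∑ i : Fin 3, (fderiv ℝ (fun z ↦ Sf₀ z (E4.basisVector i.succ) (E4.basisVector j)) q (E4.basisVector i.succ)
            - fderiv ℝ (fun z ↦ Sf₀ z (E4.basisVector i.succ) (E4.basisVector i.succ)) q (E4.basisVector j)) = 0 := by
        intro q j
        simp only [hSf₀zero]
        simp
      have hv : ∀ {q : E4}, q 0 = 0 → 0 < Kerr.radius 0 (S₀ q) → N q 0 = 0 → N q ≠ 0 → ∀ (j : Fin 4), j ≠ 0 →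
          ∑ i : Fin 3, (fderiv ℝ V₂ q (E4.basisVector i.succ) (E4.basisVector i.succ) (E4.basisVector j)
            - fderiv ℝ V₂ q (E4.basisVector j) (E4.basisVector i.succ) (E4.basisVector i.succ))
            + 1 * ∑ i : Fin 3, (fderiv ℝ (fun z ↦ Sf₀ z (E4.basisVector i.succ) (E4.basisVector j)) q (E4.basisVector i.succ)
            - fderiv ℝ (fun z ↦ Sf₀ z (E4.basisVector i.succ) (E4.basisVector i.succ)) q (E4.basisVector j)) = 0 := by
        intro q hq0 hq hNq0 hNq j hj
        have h := hrowsII hq0 hq hNq0 hNq j hj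
        rw [ha, zero_mul, zero_add] at h
        rw [hz, mul_zero, add_zero, bk_sum_swap, h, neg_zero]
      obtain ⟨h1, h2, h3, -, -, -⟩ := bk_far_translationSpin hs0 hs1 one_ne_zero hw 0 0 0 (Rinv d 0) (Rinv d 1)
        (Rinv d 2) (Rinv d 3) ((Rinv.comp (0 : E4 →L[ℝ] E4)).comp Rr) hA₂form (Rinv d) hd' V₂ hV₂' Sf₀ hSf₀'
        (hv hP0 hPr hPN0 hPN 1 (by decide)) (hv hP0 hPr hPN0 hPN 2 (by decide)) (hv hP0 hPr hPN0 hPN 3 (by decide))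
        (hv hQm0 hQmr hQmN0 hQmN 1 (by decide)) (hv hAm0 hAmr hAmN0 hAmN 1 (by decide))
        (hv hAm0 hAmr hAmN0 hAmN 2 (by decide))
      exact ⟨h1, h2, h3, fun h ↦ absurd ha h⟩
    · have hv : ∀ {q : E4}, q 0 = 0 → 0 < Kerr.radius 0 (S₀ q) → N q 0 = 0 → N q ≠ 0 → ∀ (j : Fin 4), j ≠ 0 →
          ∑ i : Fin 3, (fderiv ℝ V₂ q (E4.basisVector i.succ) (E4.basisVector i.succ) (E4.basisVector j)
            - fderiv ℝ V₂ q (E4.basisVector j) (E4.basisVector i.succ) (E4.basisVector i.succ))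
            + a * ∑ i : Fin 3, (fderiv ℝ (fun z ↦ Sf z (E4.basisVector i.succ) (E4.basisVector j)) q (E4.basisVector i.succ)
            - fderiv ℝ (fun z ↦ Sf z (E4.basisVector i.succ) (E4.basisVector i.succ)) q (E4.basisVector j)) = 0 := by
        intro q hq0 hq hNq0 hNq j hj
        have h := hrowsII hq0 hq hNq0 hNq j hj
        rw [bk_sum_swap (fun i ↦ fderiv ℝ V₂ q (E4.basisVector j) (E4.basisVector i.succ) (E4.basisVector i.succ))
          (fun i ↦ fderiv ℝ V₂ q (E4.basisVector i.succ) (E4.basisVector i.succ) (E4.basisVector j)),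
          bk_sum_swap (fun i ↦ fderiv ℝ (fun z ↦ Sf z (E4.basisVector i.succ) (E4.basisVector i.succ)) q (E4.basisVector j))
          (fun i ↦ fderiv ℝ (fun z ↦ Sf z (E4.basisVector i.succ) (E4.basisVector j)) q (E4.basisVector i.succ))]
        linear_combination (-1 : ℝ) * h
      obtain ⟨h1, h2, h3, h4, h5, h6⟩ := bk_far_translationSpin hs0 hs1 ha hw σ₁' σ₂' σ₃' (Rinv d 0) (Rinv d 1)
        (Rinv d 2) (Rinv d 3) ((Rinv.comp (0 : E4 →L[ℝ] E4)).comp Rr) hA₂form (Rinv d) hd' V₂ hV₂' Sf hSf'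
        (hv hP0 hPr hPN0 hPN 1 (by decide)) (hv hP0 hPr hPN0 hPN 2 (by decide)) (hv hP0 hPr hPN0 hPN 3 (by decide))
        (hv hQm0 hQmr hQmN0 hQmN 1 (by decide)) (hv hAm0 hAmr hAmN0 hAmN 1 (by decide))
        (hv hAm0 hAmr hAmN0 hAmN 2 (by decide))
      exact ⟨h1, h2, h3, fun _ ↦ ⟨h4, h5, h6⟩⟩
  obtain ⟨hd1, hd2, hd3, hsig⟩ := hspatial
  have hdsp : E4.spatial (Rinv d) = 0 := by
    ext i; fin_cases i
    · simpa using hd1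
    · simpa using hd2
    · simpa using hd3
  have hdd : d = (Rinv d 0) • E4.basisVector 0 := by
    have h := coerMomQ_eq_smul_basisVector_zero_of_spatial_eq_zero hdsp
    calc d = Rr (Rinv d) := (hRRinv d).symm
      _ = Rr ((Rinv d 0) • E4.basisVector 0) := by rw [← h]
      _ = (Rinv d 0) • E4.basisVector 0 := by rw [map_smul, hR0]
  refine ⟨?_, ?_⟩
  · rw [hdd, map_smul]
    have : E4.spatial (E4.basisVector 0) = 0 := by ext i; simp
    rw [this, smul_zero]
  · intro ha
    obtain ⟨hσ1, hσ2, hσ3⟩ := hsig ha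
    obtain ⟨hω1, hω2⟩ := hback hσ1 hσ2 hσ3
    have h3v := hRform (E4.basisVector 3)
    ext i
    rw [h3v]
    fin_cases i <;> simp [hω1, hω2]

end Summit.FinalStateConjecture.FinalStateConjecture.Theorems.SublinearIsFree.Slaving

end
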